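/-
Copyright (c) 2026 the pub-hodgecm-mathlib formalisation cell (harness21).  Prover seat hodgecm-mathlib-LH4-p07 (g10), Track A «(D-RAM) FOUR-FRAME» squad of crux H413,
helper lane on h413 = stmt-HodgeConjecture-24833 (count-neutral); β-BOARD chair F0P3a-p01 (g37) LEDGER #16 «κ-LINE JUNCTIONS», the 16:28:41Z bonus «hR6₃ from tower 1».  2026-09-04.
-/
import Summits.HodgeConjecture.HodgeConjecture.Theorems.F0P3cDyRamOddLabelledKappaLines               -- ★ p861954 (this seat): `kappaLine_G3_of_rows`; brings ★ `…TowerSignRelationsDeep`, ★ parity, ★ `normSign_mul_of_fixed`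
import Summits.HodgeConjecture.HodgeConjecture.Theorems.F0P3cDyRamLabelledOddTowerThreeOfTowerOne     -- ★ (LH7-p07 (g0)): `finsum_stratum_G3_shell_labelledOdd_div_relIndex_eq_of_G1`, `levels_le_n0DerivedOfRecord`; brings ★ `exists_gl_rescale_swap02`, ★ `isElementDatum_rescale`
import HarnessLib

/-!
# Crux `H413`, LH4 «(D-RAM) FOUR-FRAME» road, STAGE 1b (β) — THE κ-LINE OF TOWER 3 FROM THE TOWER-1 ONE-TOKEN HEAD (`hR6₃` of ★ p861863∕p861938 from tower 1 alone)

Cell `hodgecm-mathlib` (D-0151), FLOOR 0, crux item H413 = `stmt-HodgeConjecture-24833`, route `HCCMUnconditional`; squad F0∕P3c∕LH4.  THEOREMS ONLY (no `def`, no instance, no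
notation, no `sorry`, default heartbeats); ★-only imports; lane `--supports stmt-HodgeConjecture-24833 --as helper` (count-neutral; pays NO row, states NO law).

WHAT.  ★ p861954 `kappaLine_G3_of_rows` reduces the chair's binder `hR6₃` (the κ-locus row of tower 3, symmetric-pair currency `(0, 0, ω(−1)ω_B + ω(−1)ω_A)∕4`) to ONE input: the
tower-3 per-class lattice head in one-token form on the κ-branch.  LH7-p07 (g0)'s ★ `finsum_stratum_G3_shell_labelledOdd_div_relIndex_eq_of_G1` says every G₃ row at the datum
`(α, β; n₁, n₂, n₃)` IS the G₁ row at the RESCALED datum `(α⁻¹, βα⁻¹; n₃, n₂, n₁)` (★ `isElementDatum_rescale`), `T″ = diag(α⁻¹, βα⁻¹, 1)`, slot `(0 2) i`.  So the tower-3 head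
is the TOWER-1 head at the rescaled datum — provided the tower-sign TOKENS transport: §1 proves that a token `e` of `x` at depth parameter `n` is a token of `x + y` for every
`|y| ≤ |ϖ|^{n + 2d − 1}` (the congruence is read modulo `ϖ^{m*}·π_n`, `m* = d%2 + 2d − 1`) and of `−x` with `−e`; hence (§2) `−e_A` is a token of `α⁻¹ − 1 = −(α − 1) + α⁻¹(α − 1)²`
at `n₂` and `e_C` is a token of `βα⁻¹ − 1 = (β − α) + (α⁻¹ − 1)(β − α)` at `n₃` (both corrections have exponent `≥ n₂ + n − … = n + (n₂ − 2d + 1) ≥ n + 2d − 1`, as `n₂ ≥ N₀ ≥ m*`).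
§3 HEAD `kappaHead_G3_of_G1`: the tower-3 one-token head (token `(0, 0, ω(−1)ω_B)`, ★ p861954's binder letter) from the tower-1 one-token head CLOSED OVER THE ELEMENT DATUM (`hG1`,
LH4-p11 (g9)'s stratum head so quantified — tokens `e_A′`, `e_B′` offered to it), via `ω(−e_A) = ω(−1)ω(e_A)` (★ `normSign_mul_of_fixed`), `(x, 0, 0)_{(0 2) i} = (0, 0, x)ᵢ`, and on
the deep range `n₂ + 2d ≤ n₃` (the only range with a non-zero bracket; there `n₁ = n₂` by ★ isosceles) ★ `…_of_deep₃` (`ω_B = ω_A`).  §3 `kappaLine_G3_of_G1` = ★ `kappaLine_G3_of_rows`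
∘ `kappaHead_G3_of_G1`: **the chair's `hR6₃` binder VERBATIM from `hG1` and the trunk's tokens** — with ★ p861954 (`hR6₁`) and the chair's `kappaLine_G2_of_G1` (`hR6₂`) the single
tower-1 head pays all three κ-lines of `hRest`.
HONEST LABEL.  Count-neutral transport∕junction; the tower-1 head `hG1` is a HYPOTHESIS (LH4-p11 (g9), ★-pending); `hRest`, (β) `stub_law_cleanSgn`, T₊ OPEN; `HC_CM` is proved only
modulo the 7 printed citations (2 remaining named inputs: hLiu418 = `stmt-HodgeConjecture-24832`, h413 = `stmt-HodgeConjecture-24833`) until rung 0 closes.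

## References
* [Kottwitz1986BaseChangeUnits] R. E. Kottwitz, *Base change for unit elements of Hecke algebras*, Compositio Math. 60 (1986), §1 pp. 240–241 (lattice counts by strata; symmetry
  in the split torus).
* [Rogawski1990] J. D. Rogawski, *Automorphic Representations of Unitary Groups in Three Variables*, Ann. of Math. Stud. 123 (1990), §4.9 Prop. 4.9.1 (a)(b) p. 55, Lemma 4.9.3.
* [Serre1979] J.-P. Serre, *Local Fields*, GTM 67 (1979), Ch. V §3 Cor. 3 (norm classes of units in a ramified quadratic extension).
-/

set_option autoImplicit false

noncomputable section

namespace Summit.HodgeConjecture.HodgeConjecture.Cruxes.H413.F0P3cDyRamOddLabelledKappaLineG3OfG1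

open Literature.NumberTheory.Automorphic Literature.NumberTheory.Automorphic.HermitianLattice
open Literature.NumberTheory.Automorphic.UnitaryLatticeTree Literature.NumberTheory.Automorphic.UnitaryThreeFourFrame
open Literature.NumberTheory.LocalFields Literature.NumberTheory.LocalFields.WildQuadraticDatum
open Summit.HodgeConjecture.HodgeConjecture.Cruxes.H413.F0P3cDyRamFourFramePieces
open Summit.HodgeConjecture.HodgeConjecture.Cruxes.H413.F0P3cDyRamFourFrameCensusDefs
open Summit.HodgeConjecture.HodgeConjecture.Cruxes.H413.F0P3cDyRamStageOneBDefs (mcOfRecord)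
open Summit.HodgeConjecture.HodgeConjecture.Cruxes.H413.F0P3cDyRamStageOneBDerivedDefs (n0DerivedOfRecord mcOfRecord_le_n0DerivedOfRecord)
open Summit.HodgeConjecture.HodgeConjecture.Cruxes.H413.F0P3cDyRamDiagonalTorusDefs
open Summit.HodgeConjecture.HodgeConjecture.Cruxes.H413.F0P3cDyRamDiagonalStrataDefs
open Summit.HodgeConjecture.HodgeConjecture.Cruxes.H413.F0P3cDyRamDiagonalPermutation
open Summit.HodgeConjecture.HodgeConjecture.Cruxes.H413.F0P3cDyRamDiagonalKappaPermutation (exists_gl_rescale_swap02)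
open Summit.HodgeConjecture.HodgeConjecture.Cruxes.H413.F0P3cDyRamLabelledOddCountDefs
open Summit.HodgeConjecture.HodgeConjecture.Cruxes.H413.F0P3cDyRamTowerSignRelationsDeep (normSign_towerSign_eq_of_isElementDatum_of_deep₃)
open Summit.HodgeConjecture.HodgeConjecture.Cruxes.H413.F0P3cDyRamElementDatumParity (isoceles_of_isElementDatum depth_mod_two_eq_of_isElementDatum)
open Summit.HodgeConjecture.HodgeConjecture.Cruxes.H413.F0P3cDyRamOddLabelledKappaLines (kappaLine_G3_of_rows)
open Summit.HodgeConjecture.HodgeConjecture.Cruxes.H413.F0P3cDyRamLabelledOddTowerThreeOfTowerOne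
  (finsum_stratum_G3_shell_labelledOdd_div_relIndex_eq_of_G1 levels_le_n0DerivedOfRecord)
open WithZero
open scoped Valued WithZero Matrix MatrixGroups

variable {K : Type} [Field K] [Valued K ℤᵐ⁰]

/-! ## §1  Token transport: a tower-sign token of `x` at depth parameter `n` is a token of `x + y` for `|y| ≤ |ϖ|^{n+2d−1}`, and `−e` is a token of `−x` -/

/-- **TOKEN OF A DEEP PERTURBATION.**  At a ramified datum: if `e` is a tower-sign token of `x` at depth parameter `n ≡ d (mod 2)` (the `ϖ^{m*}`-congruence of ★ `F0P3cDyRamTowerSignToken`,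
`m* = d % 2 + 2d − 1`) and `|y| ≤ |ϖ|^{n + 2d − 1}`, then `e` is a token of `x′ = x + y` at the same depth parameter: the correction `ϖ^{−m*}·y·((ϖσϖ)^{(n−d%2)∕2})⁻¹` has exponent
`(n + 2d − 1) − m* − (n − d%2) = 0`. [cite: Serre1979, Ch. V §3 Cor. 3] [cite: Rogawski1990, §4.9 p. 55] -/
theorem towerSign_congr_of_add {σ : K →+* K} {ϖ : K} {d t : ℕ} (hD : IsRamifiedQuadraticDatum σ ϖ d t) {x x' y e : K} {n : ℕ} (hpar : n % 2 = d % 2)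
    (hx' : x' = x + y) (hy : Valued.v y ≤ Valued.v ϖ ^ (n + 2 * d - 1))
    (he : Valued.v ((ϖ ^ mstarOfRecord d)⁻¹ * (x * ((ϖ * σ ϖ) ^ ((n - d % 2) / 2))⁻¹ - e * ((ϖ - σ ϖ) * ((ϖ * σ ϖ) ^ ((d - d % 2) / 2))⁻¹))) ≤ 1) :
    Valued.v ((ϖ ^ mstarOfRecord d)⁻¹ * (x' * ((ϖ * σ ϖ) ^ ((n - d % 2) / 2))⁻¹ - e * ((ϖ - σ ϖ) * ((ϖ * σ ϖ) ^ ((d - d % 2) / 2))⁻¹))) ≤ 1 := by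
  obtain ⟨-, hvσ, hϖ, -, -, hd1, -⟩ := hD
  have hϖ0 : ϖ ≠ 0 := fun h => by rw [h, map_zero] at hϖ; exact (coe_ne_zero hϖ.symm).elim
  have hvϖ0 : Valued.v ϖ ≠ 0 := (Valuation.ne_zero_iff _).2 hϖ0
  obtain ⟨k, hnk⟩ : ∃ k : ℕ, n = 2 * k + d % 2 := ⟨n / 2, by omega⟩
  have hk : (n - d % 2) / 2 = k := by omega
  rw [hk] at he ⊢
  have hms : mstarOfRecord d = d % 2 + 2 * d - 1 := rfl
  -- the split `M·(x′P − e t₊) = M·(xP − e t₊) + M·(y·P)`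
  have hid : (ϖ ^ mstarOfRecord d)⁻¹ * (x' * ((ϖ * σ ϖ) ^ k)⁻¹ - e * ((ϖ - σ ϖ) * ((ϖ * σ ϖ) ^ ((d - d % 2) / 2))⁻¹)) =
      (ϖ ^ mstarOfRecord d)⁻¹ * (x * ((ϖ * σ ϖ) ^ k)⁻¹ - e * ((ϖ - σ ϖ) * ((ϖ * σ ϖ) ^ ((d - d % 2) / 2))⁻¹)) + (ϖ ^ mstarOfRecord d)⁻¹ * (y * ((ϖ * σ ϖ) ^ k)⁻¹) := by
    rw [hx']; ring
  rw [hid]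
  refine (Valuation.map_add _ _ _).trans (max_le he ?_)
  -- the correction: `|ϖ|^{−m*} · |y| · |ϖ|^{−2k} ≤ 1`
  have hvP : Valued.v (((ϖ * σ ϖ) ^ k)⁻¹) = (Valued.v ϖ ^ (2 * k))⁻¹ := by rw [map_inv₀, map_pow, map_mul, hvσ, ← pow_two, ← pow_mul]
  have hvM : Valued.v ((ϖ ^ mstarOfRecord d)⁻¹) = (Valued.v ϖ ^ mstarOfRecord d)⁻¹ := by rw [map_inv₀, map_pow]
  rw [map_mul, map_mul, hvM, hvP]
  have hpos : ∀ m : ℕ, 0 < Valued.v ϖ ^ m := fun m => pow_pos ((Valuation.pos_iff _).2 hϖ0) m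
  have hy' : Valued.v y ≤ Valued.v ϖ ^ mstarOfRecord d * Valued.v ϖ ^ (2 * k) := by
    rw [← pow_add]
    refine hy.trans (le_of_eq ?_)
    congr 1
    omega
  calc (Valued.v ϖ ^ mstarOfRecord d)⁻¹ * (Valued.v y * (Valued.v ϖ ^ (2 * k))⁻¹)
      ≤ (Valued.v ϖ ^ mstarOfRecord d)⁻¹ * ((Valued.v ϖ ^ mstarOfRecord d * Valued.v ϖ ^ (2 * k)) * (Valued.v ϖ ^ (2 * k))⁻¹) :=
        mul_le_mul_right (mul_le_mul_left hy' _) _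
    _ = 1 := by
        rw [mul_assoc, mul_inv_cancel₀ (hpos _).ne', mul_one, inv_mul_cancel₀ (hpos _).ne']

/-- **`−e` IS A TOKEN OF `−x`** (the congruence is odd under `(x, e) ↦ (−x, −e)`). [cite: Serre1979, Ch. V §3 Cor. 3] -/
theorem towerSign_neg {σ : K →+* K} {ϖ : K} {d : ℕ} {x e : K} {k : ℕ}
    (he : Valued.v ((ϖ ^ mstarOfRecord d)⁻¹ * (x * ((ϖ * σ ϖ) ^ k)⁻¹ - e * ((ϖ - σ ϖ) * ((ϖ * σ ϖ) ^ ((d - d % 2) / 2))⁻¹))) ≤ 1) :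
    Valued.v ((ϖ ^ mstarOfRecord d)⁻¹ * (-x * ((ϖ * σ ϖ) ^ k)⁻¹ - -e * ((ϖ - σ ϖ) * ((ϖ * σ ϖ) ^ ((d - d % 2) / 2))⁻¹))) ≤ 1 := by
  have h : (ϖ ^ mstarOfRecord d)⁻¹ * (-x * ((ϖ * σ ϖ) ^ k)⁻¹ - -e * ((ϖ - σ ϖ) * ((ϖ * σ ϖ) ^ ((d - d % 2) / 2))⁻¹)) =
      -((ϖ ^ mstarOfRecord d)⁻¹ * (x * ((ϖ * σ ϖ) ^ k)⁻¹ - e * ((ϖ - σ ϖ) * ((ϖ * σ ϖ) ^ ((d - d % 2) / 2))⁻¹))) := by ring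
  rw [h, Valuation.map_neg]
  exact he

/-! ## §2  The tokens at the rescaled datum `(α⁻¹, βα⁻¹; n₃, n₂, n₁)`: `−e_A` for `α⁻¹ − 1` (depth letter `n₂`), `e_C` for `βα⁻¹ − 1` (depth letter `n₃`) -/

section Tokens

variable {σ : K →+* K} {ϖ : K} {d t : ℕ} {α β : K} {N₀ n₁ n₂ n₃ : ℕ}

/-- **`−e_A` IS A TOKEN OF `α⁻¹ − 1` AT THE DEPTH LETTER `n₂`** whenever `e_A` is a token of `α − 1` there and `m* ≤ N₀` (`α⁻¹ − 1 = −(α − 1) + α⁻¹(α − 1)²`, the square has exponent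
`2n₂ ≥ n₂ + 2d − 1`). [cite: Serre1979, Ch. V §3 Cor. 3] [cite: Rogawski1990, §4.9 p. 55] -/
theorem towerSign_inv_sub_one (hD : IsRamifiedQuadraticDatum σ ϖ d t) (hE : IsElementDatum σ ϖ N₀ α β n₁ n₂ n₃) (hN₀ : mstarOfRecord d ≤ N₀) (hpar : n₂ % 2 = d % 2)
    {eA : K} (heA : Valued.v ((ϖ ^ mstarOfRecord d)⁻¹ * ((α - 1) * ((ϖ * σ ϖ) ^ ((n₂ - d % 2) / 2))⁻¹ - eA * ((ϖ - σ ϖ) * ((ϖ * σ ϖ) ^ ((d - d % 2) / 2))⁻¹))) ≤ 1) :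
    Valued.v ((ϖ ^ mstarOfRecord d)⁻¹ * ((α⁻¹ - 1) * ((ϖ * σ ϖ) ^ ((n₂ - d % 2) / 2))⁻¹ - -eA * ((ϖ - σ ϖ) * ((ϖ * σ ϖ) ^ ((d - d % 2) / 2))⁻¹))) ≤ 1 := by
  have hvσ : ∀ a, Valued.v (σ a) = Valued.v a := hD.2.1
  have hϖ : Valued.v ϖ = exp (-1 : ℤ) := hD.2.2.1
  have hϖ1 : Valued.v ϖ ≤ 1 := by rw [hϖ, ← exp_zero, exp_le_exp]; norm_num
  have hα : α * σ α = 1 := hE.1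
  have hα0 : α ≠ 0 := fun h => by rw [h, zero_mul] at hα; exact zero_ne_one hα
  have hvα : Valued.v α = 1 := by
    have h : Valued.v α * Valued.v α = 1 := by nth_rw 2 [← hvσ α]; rw [← map_mul, hα, map_one]
    rw [← pow_two] at h
    exact ((pow_eq_one_iff).1 h).resolve_right two_ne_zero
  have hvα1 : Valued.v (α - 1) = Valued.v ϖ ^ n₂ := hE.2.2.2.2.2.2.1
  have hn₂ : N₀ ≤ n₂ := hE.2.2.2.2.2.2.2.2.2.1
  have hms : mstarOfRecord d = d % 2 + 2 * d - 1 := rfl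
  refine towerSign_congr_of_add hD hpar (x := -(α - 1)) (y := α⁻¹ * (α - 1) * (α - 1)) (by field_simp; ring) ?_ (towerSign_neg heA)
  rw [map_mul, map_mul, map_inv₀, hvα, inv_one, one_mul, hvα1, ← pow_add]
  exact pow_le_pow_right_of_le_one' hϖ1 (by omega)

/-- **`e_C` IS A TOKEN OF `βα⁻¹ − 1` AT THE DEPTH LETTER `n₃`** whenever `e_C` is a token of `β − α` there and `m* ≤ N₀` (`βα⁻¹ − 1 = (β − α) + (α⁻¹ − 1)(β − α)`, the product has
exponent `n₂ + n₃ ≥ n₃ + 2d − 1`). [cite: Serre1979, Ch. V §3 Cor. 3] [cite: Rogawski1990, §4.9 p. 55] -/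
theorem towerSign_mul_inv_sub_one (hD : IsRamifiedQuadraticDatum σ ϖ d t) (hE : IsElementDatum σ ϖ N₀ α β n₁ n₂ n₃) (hN₀ : mstarOfRecord d ≤ N₀) (hpar : n₃ % 2 = d % 2)
    {eC : K} (heC : Valued.v ((ϖ ^ mstarOfRecord d)⁻¹ * ((β - α) * ((ϖ * σ ϖ) ^ ((n₃ - d % 2) / 2))⁻¹ - eC * ((ϖ - σ ϖ) * ((ϖ * σ ϖ) ^ ((d - d % 2) / 2))⁻¹))) ≤ 1) :
    Valued.v ((ϖ ^ mstarOfRecord d)⁻¹ * ((β * α⁻¹ - 1) * ((ϖ * σ ϖ) ^ ((n₃ - d % 2) / 2))⁻¹ - eC * ((ϖ - σ ϖ) * ((ϖ * σ ϖ) ^ ((d - d % 2) / 2))⁻¹))) ≤ 1 := by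
  have hvσ : ∀ a, Valued.v (σ a) = Valued.v a := hD.2.1
  have hϖ : Valued.v ϖ = exp (-1 : ℤ) := hD.2.2.1
  have hϖ1 : Valued.v ϖ ≤ 1 := by rw [hϖ, ← exp_zero, exp_le_exp]; norm_num
  have hα : α * σ α = 1 := hE.1
  have hα0 : α ≠ 0 := fun h => by rw [h, zero_mul] at hα; exact zero_ne_one hα
  have hvα : Valued.v α = 1 := by
    have h : Valued.v α * Valued.v α = 1 := by nth_rw 2 [← hvσ α]; rw [← map_mul, hα, map_one]
    rw [← pow_two] at h
    exact ((pow_eq_one_iff).1 h).resolve_right two_ne_zero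
  have hvαi : Valued.v (α⁻¹ - 1) = Valued.v ϖ ^ n₂ := by
    rw [show α⁻¹ - 1 = -(α⁻¹ * (α - 1)) by field_simp; ring, Valuation.map_neg, map_mul, map_inv₀, hvα, inv_one, one_mul]
    exact hE.2.2.2.2.2.2.1
  have hvβα : Valued.v (β - α) = Valued.v ϖ ^ n₃ := by rw [← neg_sub, Valuation.map_neg]; exact hE.2.2.2.2.2.2.2.1
  have hn₂ : N₀ ≤ n₂ := hE.2.2.2.2.2.2.2.2.2.1
  have hms : mstarOfRecord d = d % 2 + 2 * d - 1 := rfl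
  refine towerSign_congr_of_add hD hpar (x := β - α) (y := (α⁻¹ - 1) * (β - α)) (by field_simp; ring) ?_ heC
  rw [map_mul, hvαi, hvβα, ← pow_add]
  exact pow_le_pow_right_of_le_one' hϖ1 (by omega)

end Tokens

/-! ## §3  The tower-3 one-token head and the κ-line `hR6₃` from the tower-1 one-token head closed over the element datum -/

section Heads

variable [CompleteSpace K] [Fintype 𝓀[K]] {σ : K →+* K} {ϖ : K} {d t : ℕ} {α β : K} {n₁ n₂ n₃ : ℕ}

/-- **THE TOWER-3 ONE-TOKEN HEAD FROM THE TOWER-1 ONE-TOKEN HEAD** (record letters).  Suppose `hG1`: at EVERY element datum `(α′, β′; n₁′, n₂′, n₃′)` at the derived record,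
`T′ = diag(α′, β′, 1)`, with tokens `e_A′` of `α′ − 1` (depth letter `n₂′`) and `e_B′` of `β′ − 1` (depth letter `n₁′`), the κ-branch G₁ row reads
`vᵢ(G₁(ρ,s)) = (ω(e_A′), 0, 0)ᵢ∕2 · q^{2ρ−1+s∕2} · F(n₁′)` (`2ρ + d%2 = n₂′`, `2ρ + s + d%2 < n₁′`).  Then at `(α, β; n₁, n₂, n₃)` with the trunk's tokens `e_A, e_B, e_C` the κ-branch G₃ row
reads `vᵢ(G₃(ρ,s)) = (0, 0, ω(−1)ω(e_B))ᵢ∕2 · q^{2ρ−1+s∕2} · F(n₃)` — ★ `…_eq_of_G1` at `T″ = diag(α⁻¹, βα⁻¹, 1)`, `hG1` at the rescaled datum with the §2 tokens `(−e_A, e_C)`,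
`ω(−e_A) = ω(−1)ω(e_A)`, and `ω_A = ω_B` on the deep range `n₂ + 2d ≤ n₃` (★ `…_of_deep₃`, `n₁ = n₂` by ★ isosceles), the bracket `F(n₃)` vanishing off it.
[cite: Kottwitz1986BaseChangeUnits, §1 pp. 240–241] [cite: Rogawski1990, §4.9 Prop. 4.9.1 (a)(b) p. 55, Lemma 4.9.3] [cite: Serre1979, Ch. V §3 Cor. 3] -/
theorem kappaHead_G3_of_G1 (hD : IsRamifiedQuadraticDatum σ ϖ d t) (hE : IsElementDatum σ ϖ (n0DerivedOfRecord d) α β n₁ n₂ n₃)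
    (T : GL (Fin 3) K) (hT : (T : Matrix (Fin 3) (Fin 3) K) = Matrix.diagonal ![α, β, 1])
    {eA eB eC : K} (hσeA : σ eA = eA) (heA1 : Valued.v eA = 1)
    (heA : Valued.v ((ϖ ^ mstarOfRecord d)⁻¹ * ((α - 1) * ((ϖ * σ ϖ) ^ ((n₂ - d % 2) / 2))⁻¹ - eA * ((ϖ - σ ϖ) * ((ϖ * σ ϖ) ^ ((d - d % 2) / 2))⁻¹))) ≤ 1)
    (hσeB : σ eB = eB)
    (heB : Valued.v ((ϖ ^ mstarOfRecord d)⁻¹ * ((β - 1) * ((ϖ * σ ϖ) ^ ((n₁ - d % 2) / 2))⁻¹ - eB * ((ϖ - σ ϖ) * ((ϖ * σ ϖ) ^ ((d - d % 2) / 2))⁻¹))) ≤ 1)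
    (hσeC : σ eC = eC) (heC1 : Valued.v eC = 1)
    (heC : Valued.v ((ϖ ^ mstarOfRecord d)⁻¹ * ((β - α) * ((ϖ * σ ϖ) ^ ((n₃ - d % 2) / 2))⁻¹ - eC * ((ϖ - σ ϖ) * ((ϖ * σ ϖ) ^ ((d - d % 2) / 2))⁻¹))) ≤ 1)
    (hG1 : ∀ {α' β' : K} {n₁' n₂' n₃' : ℕ} (T' : GL (Fin 3) K) {eA' eB' : K}, IsElementDatum σ ϖ (n0DerivedOfRecord d) α' β' n₁' n₂' n₃' →
      (T' : Matrix (Fin 3) (Fin 3) K) = Matrix.diagonal ![α', β', 1] →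
      σ eA' = eA' → Valued.v eA' = 1 →
        Valued.v ((ϖ ^ mstarOfRecord d)⁻¹ * ((α' - 1) * ((ϖ * σ ϖ) ^ ((n₂' - d % 2) / 2))⁻¹ - eA' * ((ϖ - σ ϖ) * ((ϖ * σ ϖ) ^ ((d - d % 2) / 2))⁻¹))) ≤ 1 →
      σ eB' = eB' → Valued.v eB' = 1 →
        Valued.v ((ϖ ^ mstarOfRecord d)⁻¹ * ((β' - 1) * ((ϖ * σ ϖ) ^ ((n₁' - d % 2) / 2))⁻¹ - eB' * ((ϖ - σ ϖ) * ((ϖ * σ ϖ) ^ ((d - d % 2) / 2))⁻¹))) ≤ 1 →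
      ∀ (ρ s : ℕ), 1 ≤ ρ → 1 ≤ s → 2 ∣ s → 2 * ρ + d % 2 = n₂' → 2 * ρ + s + d % 2 < n₁' → ∀ i : Fin 3,
        ∑ᶠ M ∈ {M : Submodule 𝒪[K] (Fin 3 → K) | M ∈ stratum σ ϖ T' ![2 * ρ, 2 * ρ + s, 2 * ρ + s] ∧
            (LatticeInLevel ϖ (d % 2) (Matrix.diagonal ![α' - 1, β' - 1, 0]) M ∧ ¬ LatticeInLevel ϖ (d % 2 + 1) (Matrix.diagonal ![α' - 1, β' - 1, 0]) M ∧
              LatticeInLevel ϖ (mcOfRecord d) (Matrix.diagonal ![(α' - 1) * (α' - 1), (β' - 1) * (β' - 1), 0]) M)},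
          (labelledOddCount σ ϖ 0 i (valueClassLabel σ ϖ (α' - 1) (β' - 1) (mstarOfRecord d) d) M : ℚ) /
            ((((unitStabilizer M).map (unitNormMap σ 3)).relIndex (fixedUnitTorus σ 3) : ℕ) : ℚ) =
          ((![normSign σ eA', 0, 0] : Fin 3 → ℤ) i : ℚ) / 2 * (Fintype.card 𝓀[K] : ℚ) ^ (2 * ρ - 1 + s / 2) *
            ((if 2 * d + d % 2 + 2 * ρ + s ≤ n₁' then (Fintype.card 𝓀[K] : ℚ) - 1 else 0) - (if n₁' + 2 = 2 * d + d % 2 + 2 * ρ + s then 1 else 0))) :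
    ∀ (ρ s : ℕ), 1 ≤ ρ → 1 ≤ s → 2 ∣ s → 2 * ρ + d % 2 = n₂ → 2 * ρ + s + d % 2 < n₃ → ∀ i : Fin 3,
      ∑ᶠ M ∈ {M : Submodule 𝒪[K] (Fin 3 → K) | M ∈ stratum σ ϖ T ![2 * ρ + s, 2 * ρ + s, 2 * ρ] ∧
          (LatticeInLevel ϖ (d % 2) (Matrix.diagonal ![α - 1, β - 1, 0]) M ∧ ¬ LatticeInLevel ϖ (d % 2 + 1) (Matrix.diagonal ![α - 1, β - 1, 0]) M ∧
            LatticeInLevel ϖ (mcOfRecord d) (Matrix.diagonal ![(α - 1) * (α - 1), (β - 1) * (β - 1), 0]) M)},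
        (labelledOddCount σ ϖ 0 i (valueClassLabel σ ϖ (α - 1) (β - 1) (mstarOfRecord d) d) M : ℚ) /
          ((((unitStabilizer M).map (unitNormMap σ 3)).relIndex (fixedUnitTorus σ 3) : ℕ) : ℚ) =
        ((![0, 0, normSign σ (-1 : K) * normSign σ eB] : Fin 3 → ℤ) i : ℚ) / 2 * (Fintype.card 𝓀[K] : ℚ) ^ (2 * ρ - 1 + s / 2) *
          ((if 2 * d + d % 2 + 2 * ρ + s ≤ n₃ then (Fintype.card 𝓀[K] : ℚ) - 1 else 0) - (if n₃ + 2 = 2 * d + d % 2 + 2 * ρ + s then 1 else 0)) := by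
  intro ρ s hρ hs h2s hloc hlt i
  -- record letters
  have hvσ : ∀ a, Valued.v (σ a) = Valued.v a := hD.2.1
  have hd1 : 1 ≤ d := hD.2.2.2.2.2.1
  obtain ⟨-, -, -, hmsN⟩ := levels_le_n0DerivedOfRecord (d := d) hd1
  have hms : mstarOfRecord d = d % 2 + 2 * d - 1 := rfl
  have hdN₀ : d ≤ n0DerivedOfRecord d := by omega
  obtain ⟨hp1, hp2, hp3⟩ := depth_mod_two_eq_of_isElementDatum hD hE hdN₀
  -- the G₃ row at `(α, β)` is the G₁ row at the rescaled datum, slot `(0 2) i`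
  obtain ⟨P, hP⟩ := exists_gl_coe_eq_permMatrix (K := K) (Equiv.swap (0 : Fin 3) 2)
  obtain ⟨T'', hT'', -⟩ := exists_gl_rescale_swap02 hE hT P hP
  rw [finsum_stratum_G3_shell_labelledOdd_div_relIndex_eq_of_G1 hD hE hT T'' hT'' ρ s i]
  -- the tower-1 head at the rescaled datum with the transported tokens `(−e_A, e_C)`
  have hσ1 : σ (-1 : K) = -1 := by rw [map_neg, map_one]
  rw [hG1 T'' (isElementDatum_rescale hvσ hE) hT'' (eA' := -eA) (eB' := eC) (by rw [map_neg, hσeA]) (by rw [Valuation.map_neg, heA1])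
    (towerSign_inv_sub_one hD hE hmsN hp2 heA) hσeC heC1 (towerSign_mul_inv_sub_one hD hE hmsN hp3 heC) ρ s hρ hs h2s hloc hlt (Equiv.swap (0 : Fin 3) 2 i)]
  by_cases hdeep : n₂ + 2 * d ≤ n₃
  · -- deep: `n₁ = n₂` by isosceles, `ω_B = ω_A` by RELATION I, and `ω(−e_A) = ω(−1)·ω(e_A)`
    have h12 : n₁ = n₂ := by
      rcases isoceles_of_isElementDatum hD hE with ⟨h, -⟩ | ⟨h, h'⟩ | ⟨h, -⟩ <;> omega
    have hrel := normSign_towerSign_eq_of_isElementDatum_of_deep₃ hD hE h12 (by omega) hp1 hσeA heA1 hσeB heA heB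
    have heA0 : eA ≠ 0 := fun h => by rw [h, map_zero] at heA1; exact zero_ne_one heA1
    have hneg : normSign σ (-eA) = normSign σ (-1 : K) * normSign σ eA := by
      rw [← neg_one_mul eA, normSign_mul_of_fixed hD hσ1 hσeA (neg_ne_zero.2 one_ne_zero) heA0]
    have hs0 : Equiv.swap (0 : Fin 3) 2 0 = 2 := Equiv.swap_apply_left _ _
    have hs1 : Equiv.swap (0 : Fin 3) 2 1 = 1 := Equiv.swap_apply_of_ne_of_ne (by decide) (by decide)
    have hs2 : Equiv.swap (0 : Fin 3) 2 2 = 0 := Equiv.swap_apply_right _ _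
    have key : ∀ j : Fin 3, ((![normSign σ (-eA), 0, 0] : Fin 3 → ℤ) (Equiv.swap (0 : Fin 3) 2 j) : ℚ) / 2 =
        ((![0, 0, normSign σ (-1 : K) * normSign σ eB] : Fin 3 → ℤ) j : ℚ) / 2 := by
      intro j
      rw [hneg, hrel]
      fin_cases j <;> simp only [Fin.zero_eta, Fin.isValue, Fin.mk_one, Fin.reduceFinMk, hs0, hs1, hs2, Matrix.cons_val_zero, Matrix.cons_val_one,
        Matrix.cons_val_two, Matrix.head_cons, Matrix.tail_cons]
    rw [key]
  · -- shallow: both brackets vanish on both sides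
    rw [if_neg (by omega), if_neg (by omega), sub_zero, mul_zero, mul_zero]

/-- **THE κ-LINE OF TOWER 3 FROM THE TOWER-1 ONE-TOKEN HEAD** — the β-table chair's binder `hR6₃` of ★ p861863 `restSum_eq_of_rows` ∕ ★ p861938 `restSum_eq_restTarget_of_rows` VERBATIM
(`κ₂ :=` ★ p861847's `hκ2` closed form, symmetric pair `(0, 0, ω(−1)ω_B + ω(−1)ω_A)∕4`), at the derived record, from the trunk's three tokens `e_A, e_B, e_C` and the tower-1 one-token
head closed over the element datum (`hG1`, as in `kappaHead_G3_of_G1`): ★ p861954 `kappaLine_G3_of_rows` ∘ `kappaHead_G3_of_G1`.  With ★ p861954 `kappaLine_G1_of_rows` (`hR6₁`)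
and the chair's `kappaLine_G2_of_G1` (`hR6₂`), ONE tower-1 head pays all three κ-lines of `hRest`. [cite: Kottwitz1986BaseChangeUnits, §1 pp. 240–241]
[cite: Rogawski1990, §4.9 Prop. 4.9.1 (a)(b) p. 55, Lemma 4.9.3] [cite: Serre1979, Ch. V §3 Cor. 3] -/
theorem kappaLine_G3_of_G1 (hD : IsRamifiedQuadraticDatum σ ϖ d t) (hE : IsElementDatum σ ϖ (n0DerivedOfRecord d) α β n₁ n₂ n₃)
    (T : GL (Fin 3) K) (hT : (T : Matrix (Fin 3) (Fin 3) K) = Matrix.diagonal ![α, β, 1])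
    {eA eB eC : K} (hσeA : σ eA = eA) (heA1 : Valued.v eA = 1)
    (heA : Valued.v ((ϖ ^ mstarOfRecord d)⁻¹ * ((α - 1) * ((ϖ * σ ϖ) ^ ((n₂ - d % 2) / 2))⁻¹ - eA * ((ϖ - σ ϖ) * ((ϖ * σ ϖ) ^ ((d - d % 2) / 2))⁻¹))) ≤ 1)
    (hσeB : σ eB = eB)
    (heB : Valued.v ((ϖ ^ mstarOfRecord d)⁻¹ * ((β - 1) * ((ϖ * σ ϖ) ^ ((n₁ - d % 2) / 2))⁻¹ - eB * ((ϖ - σ ϖ) * ((ϖ * σ ϖ) ^ ((d - d % 2) / 2))⁻¹))) ≤ 1)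
    (hσeC : σ eC = eC) (heC1 : Valued.v eC = 1)
    (heC : Valued.v ((ϖ ^ mstarOfRecord d)⁻¹ * ((β - α) * ((ϖ * σ ϖ) ^ ((n₃ - d % 2) / 2))⁻¹ - eC * ((ϖ - σ ϖ) * ((ϖ * σ ϖ) ^ ((d - d % 2) / 2))⁻¹))) ≤ 1)
    (hG1 : ∀ {α' β' : K} {n₁' n₂' n₃' : ℕ} (T' : GL (Fin 3) K) {eA' eB' : K}, IsElementDatum σ ϖ (n0DerivedOfRecord d) α' β' n₁' n₂' n₃' →
      (T' : Matrix (Fin 3) (Fin 3) K) = Matrix.diagonal ![α', β', 1] →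
      σ eA' = eA' → Valued.v eA' = 1 →
        Valued.v ((ϖ ^ mstarOfRecord d)⁻¹ * ((α' - 1) * ((ϖ * σ ϖ) ^ ((n₂' - d % 2) / 2))⁻¹ - eA' * ((ϖ - σ ϖ) * ((ϖ * σ ϖ) ^ ((d - d % 2) / 2))⁻¹))) ≤ 1 →
      σ eB' = eB' → Valued.v eB' = 1 →
        Valued.v ((ϖ ^ mstarOfRecord d)⁻¹ * ((β' - 1) * ((ϖ * σ ϖ) ^ ((n₁' - d % 2) / 2))⁻¹ - eB' * ((ϖ - σ ϖ) * ((ϖ * σ ϖ) ^ ((d - d % 2) / 2))⁻¹))) ≤ 1 →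
      ∀ (ρ s : ℕ), 1 ≤ ρ → 1 ≤ s → 2 ∣ s → 2 * ρ + d % 2 = n₂' → 2 * ρ + s + d % 2 < n₁' → ∀ i : Fin 3,
        ∑ᶠ M ∈ {M : Submodule 𝒪[K] (Fin 3 → K) | M ∈ stratum σ ϖ T' ![2 * ρ, 2 * ρ + s, 2 * ρ + s] ∧
            (LatticeInLevel ϖ (d % 2) (Matrix.diagonal ![α' - 1, β' - 1, 0]) M ∧ ¬ LatticeInLevel ϖ (d % 2 + 1) (Matrix.diagonal ![α' - 1, β' - 1, 0]) M ∧
              LatticeInLevel ϖ (mcOfRecord d) (Matrix.diagonal ![(α' - 1) * (α' - 1), (β' - 1) * (β' - 1), 0]) M)},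
          (labelledOddCount σ ϖ 0 i (valueClassLabel σ ϖ (α' - 1) (β' - 1) (mstarOfRecord d) d) M : ℚ) /
            ((((unitStabilizer M).map (unitNormMap σ 3)).relIndex (fixedUnitTorus σ 3) : ℕ) : ℚ) =
          ((![normSign σ eA', 0, 0] : Fin 3 → ℤ) i : ℚ) / 2 * (Fintype.card 𝓀[K] : ℚ) ^ (2 * ρ - 1 + s / 2) *
            ((if 2 * d + d % 2 + 2 * ρ + s ≤ n₁' then (Fintype.card 𝓀[K] : ℚ) - 1 else 0) - (if n₁' + 2 = 2 * d + d % 2 + 2 * ρ + s then 1 else 0))) :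
    ∀ (ρ s : ℕ), 1 ≤ ρ → 1 ≤ s → 2 ∣ s → 2 * ρ + d % 2 = n₂ → n₃ ≠ n₂ + s → ∀ i : Fin 3,
      ∑ᶠ M ∈ {M : Submodule 𝒪[K] (Fin 3 → K) | M ∈ stratum σ ϖ T ![2 * ρ + s, 2 * ρ + s, 2 * ρ] ∧
          (LatticeInLevel ϖ (d % 2) (Matrix.diagonal ![α - 1, β - 1, 0]) M ∧ ¬ LatticeInLevel ϖ (d % 2 + 1) (Matrix.diagonal ![α - 1, β - 1, 0]) M ∧
            LatticeInLevel ϖ (mcOfRecord d) (Matrix.diagonal ![(α - 1) * (α - 1), (β - 1) * (β - 1), 0]) M)},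
        (labelledOddCount σ ϖ 0 i (valueClassLabel σ ϖ (α - 1) (β - 1) (mstarOfRecord d) d) M : ℚ) /
          ((((unitStabilizer M).map (unitNormMap σ 3)).relIndex (fixedUnitTorus σ 3) : ℕ) : ℚ) =
        (![(0 : ℚ), 0, (normSign σ (-1 : K) : ℚ) * (normSign σ eB : ℚ) + (normSign σ (-1 : K) : ℚ) * (normSign σ eA : ℚ)] : Fin 3 → ℚ) i / 4 *
          (Fintype.card 𝓀[K] : ℚ) ^ (2 * ρ - 1 + s / 2) *
          ((if 2 * d + d % 2 + 2 * ρ + s ≤ n₃ then (Fintype.card 𝓀[K] : ℚ) - 1 else 0) - (if n₃ + 2 = 2 * d + d % 2 + 2 * ρ + s then 1 else 0)) := by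
  have hd1 : 1 ≤ d := hD.2.2.2.2.2.1
  obtain ⟨-, -, hmcN, hmsN⟩ := levels_le_n0DerivedOfRecord (d := d) hd1
  have hms : mstarOfRecord d = d % 2 + 2 * d - 1 := rfl
  have hdN₀ : d ≤ n0DerivedOfRecord d := by omega
  exact kappaLine_G3_of_rows hD hE hdN₀ hmcN T hσeA heA1 hσeB heA heB
    (kappaHead_G3_of_G1 hD hE T hT hσeA heA1 heA hσeB heB hσeC heC1 heC hG1)

end Heads

end Summit.HodgeConjecture.HodgeConjecture.Cruxes.H413.F0P3cDyRamOddLabelledKappaLineG3OfG1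

end
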